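import Summits.HodgeConjecture.CorCM.GaloisNonNormalPrimeOrder
import Mathlib.LinearAlgebra.Matrix.SpecialLinearGroup
import Mathlib.GroupTheory.SpecificGroups.Alternating
import HarnessLib

/-!
# Instances of the prime-order skew-section theorem: `SL(2,3) × H` (`|H| ≥ 4`), `A₄ × H` (`|H| ≥ 7`), `SL(2,5) × H`, `SL(2,5)`,
# `SL(2,7)` are BAD for EVERY complex conjugation

COR-CM (cell `pub-hodgecm2`), binder seat b04 (gen 33), count-neutral own lane «Galois-CM-type classification».  KERNEL ONLY:
theorems; no definition, no named fact, no `sorry`.  `HC_CM` is neither used nor claimed.  Instances of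
`CorCM/GaloisNonNormalPrimeOrder.exists_simple_degenerate_of_nonnormal_order_three` (gen 33: a NON-NORMAL subgroup of order `3` in a
Galois group of order `≥ 84` ⟹ a primitive DEGENERATE CM type).  The witnesses (an element of order `3` and a non-normalising
element) are existentials discharged by `decide +kernel` on the Mathlib models `SL(2, ZMod q)` and `alternatingGroup (Fin 4)`; the
complex conjugation never has to be located — it is whatever central involution the model isomorphism produces — so each theorem
covers EVERY `(G, c)` with the given `G`.

* `exists_simple_degenerate_of_mulEquiv_sl_two_three_prod` — `SL(2,3) × H`, `|H| ≥ 4` (dimension `12|H|`).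
* `exists_simple_degenerate_of_mulEquiv_alternating_four_prod` — `A₄ × H`, `|H| ≥ 7` (dimension `6|H|`; `A₄ × C₄` itself is
  `CorCM/GaloisAlternatingFourTimesCyclicFourDegenerate`, by certificate).
* `exists_simple_degenerate_of_mulEquiv_sl_two_five_prod`, `…_sl_two_five` — `SL(2,5) × H` (any `H`) and the binary icosahedral
  group itself (dimension `60`): a PERFECT group — no subgroup of index two, so no imaginary quadratic subfield, no totally real
  Galois factor, no abelian subgroup of index two: none of the seat's earlier criteria (gens 19–32) reaches it.
* `exists_simple_degenerate_of_mulEquiv_sl_two_seven` — `SL(2,7)` (dimension `168`), likewise perfect.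
Which of the product rows are NEW: by gen 24's real-factor theorem a product `F × H` with `c ∈ 1 × H` was already BAD whenever the CM
factor field has a primitive type; the present theorem needs no such factorisation and also covers the «diagonal» conjugations
(e.g. `(SL(2,3) × C₈, (-1, t⁴))`, where no totally real complement exists since `SL(2,3)` has no element of order `8`).

## References

* [Shimura1998] G. Shimura, *Abelian Varieties with Complex Multiplication and Modular Functions*, §6.2 Thm. 3, §8.2 Prop. 26, §32.10.
* [Gordon1999HodgeAVSurvey] B. B. Gordon, *A survey of the Hodge conjecture for abelian varieties*, Thm. 6.4, §9.3.
-/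

noncomputable section

open CategoryTheory CategoryTheory.Limits NumberField
open scoped BigOperators MatrixGroups

namespace Summit.HodgeConjecture.CorCM.GaloisModels

open Literature.NumberTheory.ComplexMultiplication
open Literature.AlgebraicGeometry.Motives (AbelianVariety CMType)
open Literature.AlgebraicGeometry.HodgeTheory
open Literature.AlgebraicGeometry.ComplexMultiplication (IsCMTypeRealisation)
open Literature.AlgebraicGeometry.Pohlmann1968
open Literature.Barriers.HodgeConjecture (divisorClassesSpan)
open Summit.HodgeConjecture.CorCM.GaloisRank

variable {K : Type} [Field K] [NumberField K] [IsCMField K] [IsGalois ℚ K]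

/-- `SL(2,3)` has a NON-NORMAL subgroup of order `3` (a Sylow `3`-subgroup; there are four). [folklore] -/
theorem sl_two_three_exists_nonnormal_three :
    ∃ u g : SL(2, ZMod 3), u ^ 3 = 1 ∧ u ≠ 1 ∧ ∀ k < 3, g * u * g⁻¹ ≠ u ^ k := by
  decide

/-- **`Gal(K/ℚ) ≅ SL(2,3) × H` with `|H| ≥ 4` (ANY finite group `H`, ANY complex conjugation): a simple DEGENERATE abelian variety
of dimension `12·|H|` with CM by `K`** and an exceptional Hodge class on some power — the subgroup `⟨(u, 1)⟩` of order `3` is not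
normal and `|G| = 24|H| ≥ 96`. Rows: `SL(2,3) × C₄`, `SL(2,3) × C₂²`, `SL(2,3) × C₈`, `SL(2,3) × Q₈`, … for every central
involution. [cite: Shimura1998, §6.2 Thm. 3, §8.2 Prop. 26 and §32.10] [cite: Gordon1999HodgeAVSurvey, Thm. 6.4 and §9.3] -/
theorem exists_simple_degenerate_of_mulEquiv_sl_two_three_prod {H : Type*} [Group H] [Fintype H] [DecidableEq H]
    (hH : 4 ≤ Fintype.card H) (e : (K ≃ₐ[ℚ] K) ≃* SL(2, ZMod 3) × H) :
    ∃ (Φ : CMType K) (φ₀ : K →+* ℂ) (A : AbelianVariety ℂ) (ι : 𝓞 K →+* End A)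
      (θ : K →+* Module.End ℂ (complexBetti A.X 1)),
      IsPrimitive (ℂ ≃+* ℂ) Φ.1 φ₀ ∧ ¬ IsNondegenerate Φ ∧ IsCMTypeRealisation Φ A ι θ ∧ A.IsSimple ∧
      A.dim = 12 * Fintype.card H ∧
      ∃ n p : ℕ, ∃ x : complexBetti (⨁ fun _ : Fin n => A).X (2 * p), IsRationalClass x ∧
        IsOfHodgeType (⨁ fun _ : Fin n => A).dim (⨁ fun _ : Fin n => A).X (2 * p) p p x ∧
        x ∉ divisorClassesSpan (⨁ fun _ : Fin n => A).X (⨁ fun _ : Fin n => A).dim p := by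
  classical
  obtain ⟨u, g, h3, h1, hnn⟩ := sl_two_three_exists_nonnormal_three
  have hcard : Fintype.card (SL(2, ZMod 3) × H) = 24 * Fintype.card H := by
    rw [Fintype.card_prod, show Fintype.card (SL(2, ZMod 3)) = 24 from rfl]
  obtain ⟨Φ, φ₀, A, ι, θ, H1, H2, H3, H4, H5, H6⟩ := exists_simple_degenerate_of_nonnormal_order_three e (u, (1 : H))
    (by rw [Prod.ext_iff]; exact ⟨by simpa using h3, by simp⟩)
    (by rw [Ne, Prod.ext_iff]; exact fun h => h1 (by simpa using h.1))
    ⟨(g, (1 : H)), fun k hk h => hnn k hk (by have := congrArg Prod.fst h; simpa using this)⟩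
    (by rw [hcard]; omega)
  exact ⟨Φ, φ₀, A, ι, θ, H1, H2, H3, H4, by rw [H5, hcard]; omega, H6⟩

/-- `SL(2,5)` has a NON-NORMAL subgroup of order `3` (there are ten). [folklore] -/
theorem sl_two_five_exists_nonnormal_three :
    ∃ u g : SL(2, ZMod 5), u ^ 3 = 1 ∧ u ≠ 1 ∧ ∀ k < 3, g * u * g⁻¹ ≠ u ^ k := by
  decide +kernel

/-- **`Gal(K/ℚ) ≅ SL(2,5) × H` (the binary icosahedral group times ANY finite group, ANY complex conjugation): a simple
DEGENERATE abelian variety of dimension `60·|H|` with CM by `K`** and an exceptional Hodge class on some power (`p = 3`, `|G| ≥ 120`).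
`SL(2,5)` is perfect: no subgroup of index `2`, so `K` has no imaginary quadratic subfield and no abelian subgroup of index two —
none of the seat's earlier criteria applies. [cite: Shimura1998, §6.2 Thm. 3, §8.2 Prop. 26 and §32.10]
[cite: Gordon1999HodgeAVSurvey, Thm. 6.4 and §9.3] -/
theorem exists_simple_degenerate_of_mulEquiv_sl_two_five_prod {H : Type*} [Group H] [Fintype H] [DecidableEq H]
    (e : (K ≃ₐ[ℚ] K) ≃* SL(2, ZMod 5) × H) :
    ∃ (Φ : CMType K) (φ₀ : K →+* ℂ) (A : AbelianVariety ℂ) (ι : 𝓞 K →+* End A)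
      (θ : K →+* Module.End ℂ (complexBetti A.X 1)),
      IsPrimitive (ℂ ≃+* ℂ) Φ.1 φ₀ ∧ ¬ IsNondegenerate Φ ∧ IsCMTypeRealisation Φ A ι θ ∧ A.IsSimple ∧
      A.dim = 60 * Fintype.card H ∧
      ∃ n p : ℕ, ∃ x : complexBetti (⨁ fun _ : Fin n => A).X (2 * p), IsRationalClass x ∧
        IsOfHodgeType (⨁ fun _ : Fin n => A).dim (⨁ fun _ : Fin n => A).X (2 * p) p p x ∧
        x ∉ divisorClassesSpan (⨁ fun _ : Fin n => A).X (⨁ fun _ : Fin n => A).dim p := by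
  classical
  obtain ⟨u, g, h3, h1, hnn⟩ := sl_two_five_exists_nonnormal_three
  have hHpos : 0 < Fintype.card H := Fintype.card_pos
  have hcard : Fintype.card (SL(2, ZMod 5) × H) = 120 * Fintype.card H := by
    rw [Fintype.card_prod, show Fintype.card (SL(2, ZMod 5)) = 120 from rfl]
  obtain ⟨Φ, φ₀, A, ι, θ, H1, H2, H3, H4, H5, H6⟩ := exists_simple_degenerate_of_nonnormal_order_three e (u, (1 : H))
    (by rw [Prod.ext_iff]; exact ⟨by simpa using h3, by simp⟩)
    (by rw [Ne, Prod.ext_iff]; exact fun h => h1 (by simpa using h.1))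
    ⟨(g, (1 : H)), fun k hk h => hnn k hk (by have := congrArg Prod.fst h; simpa using this)⟩
    (by rw [hcard]; omega)
  exact ⟨Φ, φ₀, A, ι, θ, H1, H2, H3, H4, by rw [H5, hcard]; omega, H6⟩

/-- **`Gal(K/ℚ) ≅ SL(2,5)`** (binary icosahedral, complex conjugation `= -1`): a simple DEGENERATE CM abelian `60`-fold.
[cite: Shimura1998, §6.2 Thm. 3, §8.2 Prop. 26 and §32.10] [cite: Gordon1999HodgeAVSurvey, Thm. 6.4 and §9.3] -/
theorem exists_simple_degenerate_of_mulEquiv_sl_two_five (e : (K ≃ₐ[ℚ] K) ≃* SL(2, ZMod 5)) :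
    ∃ (Φ : CMType K) (φ₀ : K →+* ℂ) (A : AbelianVariety ℂ) (ι : 𝓞 K →+* End A)
      (θ : K →+* Module.End ℂ (complexBetti A.X 1)),
      IsPrimitive (ℂ ≃+* ℂ) Φ.1 φ₀ ∧ ¬ IsNondegenerate Φ ∧ IsCMTypeRealisation Φ A ι θ ∧ A.IsSimple ∧ A.dim = 60 ∧
      ∃ n p : ℕ, ∃ x : complexBetti (⨁ fun _ : Fin n => A).X (2 * p), IsRationalClass x ∧
        IsOfHodgeType (⨁ fun _ : Fin n => A).dim (⨁ fun _ : Fin n => A).X (2 * p) p p x ∧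
        x ∉ divisorClassesSpan (⨁ fun _ : Fin n => A).X (⨁ fun _ : Fin n => A).dim p := by
  classical
  obtain ⟨u, g, h3, h1, hnn⟩ := sl_two_five_exists_nonnormal_three
  obtain ⟨Φ, φ₀, A, ι, θ, H1, H2, H3, H4, H5, H6⟩ := exists_simple_degenerate_of_nonnormal_order_three e u h3 h1
    ⟨g, hnn⟩ (by rw [show Fintype.card (SL(2, ZMod 5)) = 120 from rfl]; omega)
  exact ⟨Φ, φ₀, A, ι, θ, H1, H2, H3, H4, by rw [H5, show Fintype.card (SL(2, ZMod 5)) = 120 from rfl], H6⟩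

/-- `A₄` has a NON-NORMAL subgroup of order `3` (there are four), and `|A₄| = 12`. [folklore] -/
theorem alternating_four_exists_nonnormal_three :
    (∃ u g : alternatingGroup (Fin 4), u ^ 3 = 1 ∧ u ≠ 1 ∧ ∀ k < 3, g * u * g⁻¹ ≠ u ^ k) ∧
      Fintype.card (alternatingGroup (Fin 4)) = 12 := by
  refine ⟨by decide +kernel, ?_⟩
  have h := two_mul_card_alternatingGroup (α := Fin 4)
  rw [Fintype.card_perm, Fintype.card_fin, show Nat.factorial 4 = 24 from rfl] at h
  omega

/-- **`Gal(K/ℚ) ≅ A₄ × H` with `|H| ≥ 8` (ANY finite group `H`, ANY complex conjugation — necessarily in `1 × Z(H)`): a simple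
DEGENERATE abelian variety of dimension `6·|H|` with CM by `K`** (`p = 3`, `|G| = 12|H| ≥ 96`).  Rows `A₄ × C₈`, `A₄ × Q₈`,
`A₄ × C₂ × C₄`, … (the seat's sampling census found no degenerate type for `A₄ × C₈` in 200 samples: skew types are rare but exist).
[cite: Shimura1998, §6.2 Thm. 3, §8.2 Prop. 26 and §32.10] [cite: Gordon1999HodgeAVSurvey, Thm. 6.4 and §9.3] -/
theorem exists_simple_degenerate_of_mulEquiv_alternating_four_prod {H : Type*} [Group H] [Fintype H] [DecidableEq H]
    (hH : 7 ≤ Fintype.card H) (e : (K ≃ₐ[ℚ] K) ≃* alternatingGroup (Fin 4) × H) :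
    ∃ (Φ : CMType K) (φ₀ : K →+* ℂ) (A : AbelianVariety ℂ) (ι : 𝓞 K →+* End A)
      (θ : K →+* Module.End ℂ (complexBetti A.X 1)),
      IsPrimitive (ℂ ≃+* ℂ) Φ.1 φ₀ ∧ ¬ IsNondegenerate Φ ∧ IsCMTypeRealisation Φ A ι θ ∧ A.IsSimple ∧
      A.dim = 6 * Fintype.card H ∧
      ∃ n p : ℕ, ∃ x : complexBetti (⨁ fun _ : Fin n => A).X (2 * p), IsRationalClass x ∧
        IsOfHodgeType (⨁ fun _ : Fin n => A).dim (⨁ fun _ : Fin n => A).X (2 * p) p p x ∧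
        x ∉ divisorClassesSpan (⨁ fun _ : Fin n => A).X (⨁ fun _ : Fin n => A).dim p := by
  classical
  obtain ⟨⟨u, g, h3, h1, hnn⟩, hA⟩ := alternating_four_exists_nonnormal_three
  have hcard : Fintype.card (alternatingGroup (Fin 4) × H) = 12 * Fintype.card H := by rw [Fintype.card_prod, hA]
  obtain ⟨Φ, φ₀, A, ι, θ, H1, H2, H3, H4, H5, H6⟩ := exists_simple_degenerate_of_nonnormal_order_three e (u, (1 : H))
    (by rw [Prod.ext_iff]; exact ⟨by simpa using h3, by simp⟩)
    (by rw [Ne, Prod.ext_iff]; exact fun h => h1 (by simpa using h.1))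
    ⟨(g, (1 : H)), fun k hk h => hnn k hk (by have := congrArg Prod.fst h; simpa using this)⟩
    (by rw [hcard]; omega)
  exact ⟨Φ, φ₀, A, ι, θ, H1, H2, H3, H4, by rw [H5, hcard]; omega, H6⟩

/-- `SL(2,7)` has a NON-NORMAL subgroup of order `3`, and `|SL(2,7)| = 336`. [folklore] -/
theorem sl_two_seven_exists_nonnormal_three :
    (∃ u g : SL(2, ZMod 7), u ^ 3 = 1 ∧ u ≠ 1 ∧ ∀ k < 3, g * u * g⁻¹ ≠ u ^ k) ∧ Fintype.card (SL(2, ZMod 7)) = 336 := by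
  refine ⟨by decide +kernel, by decide +kernel⟩

/-- **`Gal(K/ℚ) ≅ SL(2,7)`** (complex conjugation `= -1`, the unique involution): a simple DEGENERATE CM abelian `168`-fold with an
exceptional Hodge class on some power.  Another perfect group: no index-two phenomena at all.
[cite: Shimura1998, §6.2 Thm. 3, §8.2 Prop. 26 and §32.10] [cite: Gordon1999HodgeAVSurvey, Thm. 6.4 and §9.3] -/
theorem exists_simple_degenerate_of_mulEquiv_sl_two_seven (e : (K ≃ₐ[ℚ] K) ≃* SL(2, ZMod 7)) :
    ∃ (Φ : CMType K) (φ₀ : K →+* ℂ) (A : AbelianVariety ℂ) (ι : 𝓞 K →+* End A)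
      (θ : K →+* Module.End ℂ (complexBetti A.X 1)),
      IsPrimitive (ℂ ≃+* ℂ) Φ.1 φ₀ ∧ ¬ IsNondegenerate Φ ∧ IsCMTypeRealisation Φ A ι θ ∧ A.IsSimple ∧ A.dim = 168 ∧
      ∃ n p : ℕ, ∃ x : complexBetti (⨁ fun _ : Fin n => A).X (2 * p), IsRationalClass x ∧
        IsOfHodgeType (⨁ fun _ : Fin n => A).dim (⨁ fun _ : Fin n => A).X (2 * p) p p x ∧
        x ∉ divisorClassesSpan (⨁ fun _ : Fin n => A).X (⨁ fun _ : Fin n => A).dim p := by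
  classical
  obtain ⟨⟨u, g, h3, h1, hnn⟩, hc⟩ := sl_two_seven_exists_nonnormal_three
  obtain ⟨Φ, φ₀, A, ι, θ, H1, H2, H3, H4, H5, H6⟩ := exists_simple_degenerate_of_nonnormal_order_three e u h3 h1
    ⟨g, hnn⟩ (by rw [hc]; omega)
  exact ⟨Φ, φ₀, A, ι, θ, H1, H2, H3, H4, by rw [H5, hc], H6⟩

end Summit.HodgeConjecture.CorCM.GaloisModels

end
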